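import Literature.Topology.FourManifolds.GeneralPush
import HarnessLib

/-!
# The general push as a family in the parameter `θ`

Topic `Literature/Topology/FourManifolds` (programme of the fact
`Literature.Topology.FourManifolds.exists_isSimplifiedBrokenLefschetzFibration`, Baykur–Saeki 2017, §2.1,
§3).  For the normal-crossing induction every condition already achieved must survive the
later pushes; all of them are open conditions in the push parameter `θ` over compact sets,
given the CONTINUITY of the family `θ ↦ g_θ` (`GeneralPush.pushed`) proved here:

* `GeneralPush.continuousOn_family` — `(θ, q) ↦ g_θ(q)` is continuous on `{‖θ‖ < δ} × X`;
* `GeneralPush.contDiffOn_family_arc` — for a smooth arc `γ` and a smooth chart `ψ'` of `B`,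
  `(θ, t) ↦ ψ'(g_θ(γ t))` is `C^∞` on the (open) set where `‖θ‖ < δ`, `t` is in the domain
  of the arc and `g_θ(γ t) ∈ ψ'.source`; hence its `t`-derivative is jointly continuous there
  (`GeneralPush.continuousOn_deriv_family_arc`).

Everything is proved; no definitions, no named facts (D-0026).

## References

* R. İ. Baykur, O. Saeki, *Simplifying indefinite fibrations on 4-manifolds*, arXiv:1705.11169,
  §2.1 p. 6, §3. [BaykurSaeki2017]
* M. Golubitsky, V. Guillemin, *Stable Mappings and Their Singularities*, GTM 14 (1973), Ch. III
  §4. [GolubitskyGuillemin1973]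
-/

noncomputable section

set_option maxSynthPendingDepth 2

open Set Function Filter Module Metric
open scoped ContDiff Topology Manifold

namespace Literature.Topology.FourManifolds

/-- Local notation: `𝔼 n` is the model Euclidean space `EuclideanSpace ℝ (Fin n)`. -/
local notation "𝔼 " n:arg => EuclideanSpace ℝ (Fin n)

namespace GeneralPush

variable {X : Type*} [TopologicalSpace X] [ChartedSpace (𝔼 4) X]
  {B : Type*} [TopologicalSpace B] [ChartedSpace (𝔼 2) B]
  {g : X → B} {ψ : OpenPartialHomeomorph B (𝔼 2)} {b : X → ℝ} {δ : ℝ}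

/-! ### Joint continuity of the values -/

omit [ChartedSpace (𝔼 4) X] [ChartedSpace (𝔼 2) B] in
/-- **`(θ, q) ↦ g_θ(q)` is jointly continuous** within the margin. [folklore] -/
theorem continuousOn_family (hg : Continuous g) (hbc : Continuous b)
    (hbt : tsupport b ⊆ g ⁻¹' ψ.source)
    (hδ : ∀ θ : 𝔼 2, ‖θ‖ < δ → ∀ q, g q ∈ ψ.source → ψ (g q) + b q • θ ∈ ψ.target) :
    ContinuousOn (fun p : 𝔼 2 × X => pushed g ψ b p.1 p.2)
      (ball (0 : 𝔼 2) δ ×ˢ (univ : Set X)) := by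
  set S : Set X := g ⁻¹' ψ.source with hS
  have hSo : IsOpen S := ψ.open_source.preimage hg
  -- on `ball × S`
  have hinner : ContinuousOn (fun p : 𝔼 2 × X => ψ (g p.2) + b p.2 • p.1)
      (ball (0 : 𝔼 2) δ ×ˢ S) := by
    refine ContinuousOn.add ?_
      (((hbc.comp continuous_snd).smul continuous_fst).continuousOn)
    exact ψ.continuousOn.comp (hg.comp continuous_snd).continuousOn fun p hp => hp.2
  have hmaps : MapsTo (fun p : 𝔼 2 × X => ψ (g p.2) + b p.2 • p.1) (ball (0 : 𝔼 2) δ ×ˢ S)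
      ψ.target := fun p hp => hδ p.1 (mem_ball_zero_iff.1 hp.1) p.2 hp.2
  have h1 : ContinuousOn (fun p : 𝔼 2 × X => pushed g ψ b p.1 p.2) (ball (0 : 𝔼 2) δ ×ˢ S) :=
    (ψ.continuousOn_symm.comp hinner hmaps).congr fun p hp => pushed_of_mem hp.2
  -- on `univ × (tsupport b)ᶜ`
  have h2 : ContinuousOn (fun p : 𝔼 2 × X => pushed g ψ b p.1 p.2)
      ((univ : Set (𝔼 2)) ×ˢ (tsupport b)ᶜ) :=
    (hg.comp continuous_snd).continuousOn.congr fun p hp => pushed_eq_of_notMem_tsupport hp.2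
  rintro ⟨θ, q⟩ ⟨hθ, -⟩
  by_cases hq : q ∈ S
  · exact (h1.continuousAt (prod_mem_nhds (isOpen_ball.mem_nhds hθ)
      (hSo.mem_nhds hq))).continuousWithinAt
  · have hqt : q ∉ tsupport b := fun h => hq (hbt h)
    exact (h2.continuousAt (prod_mem_nhds univ_mem
      ((isClosed_tsupport b).isOpen_compl.mem_nhds hqt))).continuousWithinAt

/-! ### Joint smoothness along an arc, read in a chart -/

section Arc

variable {ψ' : OpenPartialHomeomorph B (𝔼 2)} {γ : ℝ → X} {I : Set ℝ}

omit [ChartedSpace (𝔼 4) X] [ChartedSpace (𝔼 2) B] in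
/-- The domain of the family along the arc `γ` read in the chart `ψ'`. [folklore] -/
theorem isOpen_familyArcDom (hg : Continuous g) (hbc : Continuous b)
    (hbt : tsupport b ⊆ g ⁻¹' ψ.source)
    (hδ : ∀ θ : 𝔼 2, ‖θ‖ < δ → ∀ q, g q ∈ ψ.source → ψ (g q) + b q • θ ∈ ψ.target)
    (hI : IsOpen I) (hγc : ContinuousOn γ I) :
    IsOpen {p : 𝔼 2 × ℝ | ‖p.1‖ < δ ∧ p.2 ∈ I ∧ pushed g ψ b p.1 (γ p.2) ∈ ψ'.source} := by
  have h1 : ContinuousOn (fun p : 𝔼 2 × ℝ => (p.1, γ p.2)) (ball (0 : 𝔼 2) δ ×ˢ I) :=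
    continuousOn_fst.prodMk (hγc.comp continuousOn_snd fun p hp => hp.2)
  have hmaps : MapsTo (fun p : 𝔼 2 × ℝ => (p.1, γ p.2)) (ball (0 : 𝔼 2) δ ×ˢ I)
      (ball (0 : 𝔼 2) δ ×ˢ (univ : Set X)) := fun p hp => ⟨hp.1, mem_univ _⟩
  have h2 := (continuousOn_family hg hbc hbt hδ).comp h1 hmaps
  have h3 := h2.isOpen_inter_preimage (isOpen_ball.prod hI) ψ'.open_source
  have hset : {p : 𝔼 2 × ℝ | ‖p.1‖ < δ ∧ p.2 ∈ I ∧ pushed g ψ b p.1 (γ p.2) ∈ ψ'.source} =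
      ball (0 : 𝔼 2) δ ×ˢ I ∩ ((fun p : 𝔼 2 × X => pushed g ψ b p.1 p.2) ∘
        fun p : 𝔼 2 × ℝ => (p.1, γ p.2)) ⁻¹' ψ'.source := by
    ext p
    simp only [mem_setOf_eq, mem_inter_iff, mem_prod, mem_ball_zero_iff, mem_preimage,
      Function.comp_apply, and_assoc]
  rw [hset]
  exact h3

/-- **`(θ, t) ↦ ψ'(g_θ(γ t))` is `C^∞`** on its natural open domain, for a smooth arc `γ` and
a smooth chart `ψ'`. [folklore] -/
theorem contDiffOn_family_arc (hg : ContMDiff (𝓡 4) (𝓡 2) ∞ g)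
    (hψ : ContMDiffOn (𝓡 2) (𝓡 2) ∞ ψ ψ.source) (hψs : ContMDiffOn (𝓡 2) (𝓡 2) ∞ ψ.symm ψ.target)
    (hψ' : ContMDiffOn (𝓡 2) (𝓡 2) ∞ ψ' ψ'.source)
    (hb : ContMDiff (𝓡 4) 𝓘(ℝ, ℝ) ∞ b) (hbt : tsupport b ⊆ g ⁻¹' ψ.source)
    (hδ : ∀ θ : 𝔼 2, ‖θ‖ < δ → ∀ q, g q ∈ ψ.source → ψ (g q) + b q • θ ∈ ψ.target)
    (hI : IsOpen I) (hγ : ContMDiffOn 𝓘(ℝ, ℝ) (𝓡 4) ∞ γ I) :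
    ContDiffOn ℝ ∞ (fun p : 𝔼 2 × ℝ => ψ' (pushed g ψ b p.1 (γ p.2)))
      {p : 𝔼 2 × ℝ | ‖p.1‖ < δ ∧ p.2 ∈ I ∧ pushed g ψ b p.1 (γ p.2) ∈ ψ'.source} := by
  set Ω : Set (𝔼 2 × ℝ) :=
    {p : 𝔼 2 × ℝ | ‖p.1‖ < δ ∧ p.2 ∈ I ∧ pushed g ψ b p.1 (γ p.2) ∈ ψ'.source} with hΩ
  have hγc : ContinuousOn γ I := hγ.continuousOn
  -- the two open pieces
  set Ω₁ : Set (𝔼 2 × ℝ) := Ω ∩ {p | p.2 ∈ I ∧ g (γ p.2) ∈ ψ.source} with hΩ₁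
  set Ω₂ : Set (𝔼 2 × ℝ) := Ω ∩ {p | p.2 ∈ I ∧ γ p.2 ∉ tsupport b} with hΩ₂
  have hΩo : IsOpen Ω := isOpen_familyArcDom hg.continuous hb.continuous hbt hδ hI hγc
  have hA : IsOpen {u : ℝ | u ∈ I ∧ g (γ u) ∈ ψ.source} :=
    hγc.isOpen_inter_preimage hI (ψ.open_source.preimage hg.continuous)
  have hA' : IsOpen {u : ℝ | u ∈ I ∧ γ u ∉ tsupport b} :=
    hγc.isOpen_inter_preimage hI (isClosed_tsupport b).isOpen_compl
  have hΩ₁o : IsOpen Ω₁ := hΩo.inter (hA.preimage continuous_snd)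
  have hΩ₂o : IsOpen Ω₂ := hΩo.inter (hA'.preimage continuous_snd)
  -- smoothness of the chart curve and of the bump along the arc
  have hc : ContDiffOn ℝ ∞ (fun u => ψ (g (γ u))) {u | u ∈ I ∧ g (γ u) ∈ ψ.source} :=
    contMDiffOn_iff_contDiffOn.1 (hψ.comp (hg.comp_contMDiffOn (hγ.mono fun u hu => hu.1))
      fun u hu => hu.2)
  have hbγ : ContDiffOn ℝ ∞ (fun u => b (γ u)) I :=
    contMDiffOn_iff_contDiffOn.1 (hb.comp_contMDiffOn hγ)
  have hT : ContDiffOn ℝ ∞ (ψ' ∘ ψ.symm) (ψ.target ∩ ψ.symm ⁻¹' ψ'.source) :=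
    contMDiffOn_iff_contDiffOn.1 (hψ'.comp (hψs.mono inter_subset_left) fun w hw => hw.2)
  have hc' : ContDiffOn ℝ ∞ (ψ' ∘ g ∘ γ) {u | u ∈ I ∧ g (γ u) ∈ ψ'.source} :=
    contMDiffOn_iff_contDiffOn.1 (hψ'.comp (hg.comp_contMDiffOn (hγ.mono fun u hu => hu.1))
      fun u hu => hu.2)
  -- piece 1
  have h1 : ContDiffOn ℝ ∞ (fun p : 𝔼 2 × ℝ => ψ' (pushed g ψ b p.1 (γ p.2))) Ω₁ := by
    have hinner : ContDiffOn ℝ ∞ (fun p : 𝔼 2 × ℝ => ψ (g (γ p.2)) + b (γ p.2) • p.1) Ω₁ :=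
      ((hc.comp contDiffOn_snd fun p hp => hp.2).add
        ((hbγ.comp contDiffOn_snd fun p hp => hp.2.1).smul contDiffOn_fst))
    have hmaps : MapsTo (fun p : 𝔼 2 × ℝ => ψ (g (γ p.2)) + b (γ p.2) • p.1) Ω₁
        (ψ.target ∩ ψ.symm ⁻¹' ψ'.source) := by
      intro p hp
      refine ⟨hδ p.1 hp.1.1 _ hp.2.2, ?_⟩
      show ψ.symm (ψ (g (γ p.2)) + b (γ p.2) • p.1) ∈ ψ'.source
      rw [← pushed_of_mem hp.2.2]
      exact hp.1.2.2
    refine (hT.comp hinner hmaps).congr fun p hp => ?_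
    simp only [Function.comp_apply, pushed_of_mem hp.2.2]
  -- piece 2
  have h2 : ContDiffOn ℝ ∞ (fun p : 𝔼 2 × ℝ => ψ' (pushed g ψ b p.1 (γ p.2))) Ω₂ := by
    have hmaps : MapsTo (fun p : 𝔼 2 × ℝ => p.2) Ω₂ {u | u ∈ I ∧ g (γ u) ∈ ψ'.source} := by
      intro p hp
      refine ⟨hp.2.1, ?_⟩
      have := hp.1.2.2
      rwa [pushed_eq_of_notMem_tsupport hp.2.2] at this
    refine ((hc'.comp contDiffOn_snd hmaps)).congr fun p hp => ?_
    simp only [Function.comp_apply, pushed_eq_of_notMem_tsupport hp.2.2]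
  -- assemble
  intro p hp
  by_cases hps : g (γ p.2) ∈ ψ.source
  · have hp1 : p ∈ Ω₁ := ⟨hp, hp.2.1, hps⟩
    exact (h1.contDiffAt (hΩ₁o.mem_nhds hp1)).contDiffWithinAt
  · have hpt : γ p.2 ∉ tsupport b := fun h => hps (hbt h)
    have hp2 : p ∈ Ω₂ := ⟨hp, hp.2.1, hpt⟩
    exact (h2.contDiffAt (hΩ₂o.mem_nhds hp2)).contDiffWithinAt

/-- **The `t`-derivative of `ψ'(g_θ(γ t))` is jointly continuous in `(θ, t)`** on the natural
domain. [folklore] -/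
theorem continuousOn_deriv_family_arc (hg : ContMDiff (𝓡 4) (𝓡 2) ∞ g)
    (hψ : ContMDiffOn (𝓡 2) (𝓡 2) ∞ ψ ψ.source) (hψs : ContMDiffOn (𝓡 2) (𝓡 2) ∞ ψ.symm ψ.target)
    (hψ' : ContMDiffOn (𝓡 2) (𝓡 2) ∞ ψ' ψ'.source)
    (hb : ContMDiff (𝓡 4) 𝓘(ℝ, ℝ) ∞ b) (hbt : tsupport b ⊆ g ⁻¹' ψ.source)
    (hδ : ∀ θ : 𝔼 2, ‖θ‖ < δ → ∀ q, g q ∈ ψ.source → ψ (g q) + b q • θ ∈ ψ.target)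
    (hI : IsOpen I) (hγ : ContMDiffOn 𝓘(ℝ, ℝ) (𝓡 4) ∞ γ I) :
    ContinuousOn (fun p : 𝔼 2 × ℝ => deriv (fun t => ψ' (pushed g ψ b p.1 (γ t))) p.2)
      {p : 𝔼 2 × ℝ | ‖p.1‖ < δ ∧ p.2 ∈ I ∧ pushed g ψ b p.1 (γ p.2) ∈ ψ'.source} := by
  set Ω : Set (𝔼 2 × ℝ) :=
    {p : 𝔼 2 × ℝ | ‖p.1‖ < δ ∧ p.2 ∈ I ∧ pushed g ψ b p.1 (γ p.2) ∈ ψ'.source} with hΩ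
  set F : 𝔼 2 × ℝ → 𝔼 2 := fun p => ψ' (pushed g ψ b p.1 (γ p.2)) with hF
  have hΩo : IsOpen Ω :=
    isOpen_familyArcDom hg.continuous hb.continuous hbt hδ hI hγ.continuousOn
  have hFs : ContDiffOn ℝ ∞ F Ω := contDiffOn_family_arc hg hψ hψs hψ' hb hbt hδ hI hγ
  have hderiv : ∀ p ∈ Ω, deriv (fun t => ψ' (pushed g ψ b p.1 (γ t))) p.2 =
      fderiv ℝ F p ((0 : 𝔼 2), (1 : ℝ)) := by
    rintro ⟨θ, t⟩ hp
    have hFd : HasFDerivAt F (fderiv ℝ F (θ, t)) (θ, t) :=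
      ((hFs.contDiffAt (hΩo.mem_nhds hp)).differentiableAt (by simp)).hasFDerivAt
    have hincl : HasDerivAt (fun t' : ℝ => ((θ, t') : 𝔼 2 × ℝ)) ((0 : 𝔼 2), (1 : ℝ)) t :=
      (hasDerivAt_const t θ).prodMk (hasDerivAt_id t)
    have hcomp := hFd.comp_hasDerivAt t hincl
    exact hcomp.deriv
  have hcont : ContinuousOn (fun p => fderiv ℝ F p ((0 : 𝔼 2), (1 : ℝ))) Ω :=
    (hFs.continuousOn_fderiv_of_isOpen hΩo (by simp)).clm_apply continuousOn_const
  exact hcont.congr fun p hp => hderiv p hp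

end Arc

end GeneralPush

end Literature.Topology.FourManifolds
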